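import Summits.NavierStokesRegularity.NavierStokesRegularity.Theorems.PumpContinuationMildBlowupClassical
import Summits.NavierStokesRegularity.NavierStokesRegularity.Theorems.Target.Negative.CounterexampleProfile

/-!
# Crux `BoundedTemperatureClosed` (stmt-NavierStokesRegularity-18303), negative side:
# the temperature floor in Tao's mild class (Leray 1934)

Support lemmas of the line lead (line `Sketch`, lead c1; `--supports`, nothing here closes the item):
the one clause of the zero-datum analysis of this crux that is PROVABLE from the tree.

* `exists_linked_maximalSmooth` — **the mild blow-up time is the classical lifespan.** An
  `H¹⁰_df`-mild solution `u` of the true Navier–Stokes form (Tao 2016 (1.5)/(1.15), `ν = 1`) from a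
  Schwartz divergence-free datum `u₀` on `[0,S)` with no mild extension past `S` IS, slice-wise a.e. and
  after complexification, a maximal smooth solution `w` on `[0,S)`, Leray–Hopf from `w 0 = u₀`. This is
  the proved `pumpContinuation_mildBlowupClassical_proof` (stmt-18304) re-run KEEPING the identification
  (`u t = [(w t)^ℂ]`, uniqueness of `H¹⁰_df`-mild solutions) and the equality of times (`T_Kato ≤ S` by
  no-mild-extension, `S ≤ T_Kato` by the back end of `EulerTypeIGlue`).
* `typeI_constant_ge` — **temperature floor (Leray 1934 in the mild class).** With Leray's universal
  constant `c > 0` (`leray_blowup_rate_top_holds`, packaged as `counterexample_leray_lower_bound`): every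
  Schwartz-data `H¹⁰_df`-mild Type-I blow-up `‖u t‖_∞ ≤ K/√(S-t)` of Navier–Stokes with no mild
  extension has `c ≤ K`.
* `exists_pos_forall_nsTypeI_le`, `not_forall_pos_nsTypeI` — hence the set of admissible Type-I
  ceilings of Schwartz-data mild Navier–Stokes blow-ups is bounded below by a POSITIVE constant: the
  "temperature floor" that the zero-datum analysis of this crux (`Negative/ZeroDatumTools`,
  `Negative/ZeroDatumDichotomy`, the disprover's negative lemma) had to carry as an open clause is a
  theorem. Consequences for the registered stubs of line `Sketch` are drawn in `ZeroDatumFloor.lean`.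

## References

* J. Leray, Acta Math. 63 (1934), §19 (3.9) (lower bound on the blow-up rate). [Leray1934]
* T. Tao, J. Amer. Math. Soc. 29 (2016), arXiv:1402.0290v3, §1.1 (1.5), (1.15). [Tao2016AveragedNS]
* P. G. Lemarié-Rieusset, *The Navier–Stokes problem in the 21st century*, Thm. 15.1, Prop. 12.3.
-/

noncomputable section

open MeasureTheory Set Filter Topology FourierTransform Function
open scoped ENNReal NNReal RealInnerProductSpace SchwartzMap ContDiff

-- the nested summit namespace `…NavierStokesRegularity.NavierStokesRegularity…` is the tree's layout
-- (D-0017), so the duplicated-namespace linter must be silenced for every declaration below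
set_option linter.dupNamespace false

namespace Summit.NavierStokesRegularity.NavierStokesRegularity.Theorems

open Literature.Analysis.FluidPDE Literature.Analysis.FluidPDE.Tao2016
open Literature.Analysis.FunctionSpaces (eFourierSobolevNorm)
open Literature.Analysis.FunctionSpaces.EuclideanSpace (complexify complexify_apply norm_complexify
  continuous_complexify)
open PumpContinuationMildBlowupClassical

namespace BoundedTemperatureClosed.Negative

/-- **The mild blow-up time is the classical lifespan, and the mild solution is the classical one.**
An `H¹⁰_df`-mild solution of the Navier–Stokes form (Tao (1.5), `ν = 1`) from a Schwartz divergence-free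
datum `u₀` on `[0,S)` with no mild extension past `S` is slice-wise a.e. the complexification of a maximal
smooth solution `w` on `[0,S)`, Leray–Hopf on `[0,S]` from `w 0 = u₀`. Proof: steps 1–5 of
`pumpContinuation_mildBlowupClassical_proof` verbatim (Kato maximal time `T`, glued Tao-class solutions,
Leray–Hopf completion, singular point), then `T ≤ S` (else the mild curve of `w` extends `u`, by
uniqueness of `H¹⁰_df`-mild solutions) and `S ≤ T` (else `u` continues `w` classically past `T`,
`PerpetualPumpEulerTypeIGlue.stub_backEnd`). [cite: Tao2016AveragedNS, §1.1 (1.5), (1.15)] -/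
theorem exists_linked_maximalSmooth (u₀ : 𝓢(EuclideanSpace ℝ (Fin 3), EuclideanSpace ℝ (Fin 3)))
    (hdiv : VectorCalculus.IsDivFree ⇑u₀) {S : ℝ} (hS : 0 < S) {u : ℝ → L2C}
    (hu : IsMildSolutionFor eulerForm (schwartzL2 u₀) (Ico 0 S) u)
    (hnoext : ¬ ∃ S' : ℝ, S < S' ∧ ∃ v : ℝ → L2C,
      IsMildSolutionFor eulerForm (schwartzL2 u₀) (Ico 0 S') v ∧ ∀ t ∈ Ico 0 S, v t = u t) :
    ∃ (w : ℝ → EuclideanSpace ℝ (Fin 3) → EuclideanSpace ℝ (Fin 3)) (p : ℝ → EuclideanSpace ℝ (Fin 3) → ℝ),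
      IsMaximalSmoothSolution 1 0 w p S ∧ IsLerayHopfOn S 1 0 (w 0) w ∧ w 0 = ⇑u₀ ∧
      ∀ t ∈ Ico 0 S,
        ((u t : L2C) : EuclideanSpace ℝ (Fin 3) → EuclideanSpace ℂ (Fin 3)) =ᵐ[volume] complexify ∘ w t := by
  classical
  -- the datum
  have hsm : ContDiff ℝ ∞ (⇑u₀) := u₀.smooth ⊤
  have hdec : HasRapidSpatialDecay (⇑u₀) := hasRapidSpatialDecay_schwartz u₀
  have hdivW : NSWave0.IsDivFree (⇑u₀) := fun x => hdiv x
  have h2 : MemLp (⇑u₀) 2 (volume : Measure (EuclideanSpace ℝ (Fin 3))) := u₀.memLp 2 _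
  have h3 : MemLp (⇑u₀) 3 (volume : Measure (EuclideanSpace ℝ (Fin 3))) := u₀.memLp 3 _
  have hwdiv : IsWeaklyDivFree (⇑u₀) :=
    VectorCalculus.IsDivFree.isWeaklyDivFree_holds hdiv (hsm.of_le (mod_cast le_top))
  /- Step 1: `u₀` has no global Kato solution (else a mild extension of `u` past `S`). -/
  have hng : ¬ HasGlobalKatoSolution 1 (⇑u₀) := by
    intro hK
    have hS1 : 0 < S + 1 := by linarith
    obtain ⟨v, q, hv⟩ :=
      exists_isTaoSolutionOn_of_hasGlobalKatoSolution' one_pos hsm hdivW hdec hK hS1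
    have hcl : IsClassicalNSSolutionOn (Ico 0 (S + 1)) 1 0 v q :=
      hv.classical.mono Ico_subset_Icc_self (uniqueDiffOn_Ico 0 (S + 1))
    obtain ⟨V, hV, -⟩ :=
      exists_isMildSolutionFor_of_classical hS1 u₀ hcl (hv.isLerayHopfOn hS1) hv.initial
    refine hnoext ⟨S + 1, by linarith, V, hV, fun t ht => ?_⟩
    have hV' : IsMildSolutionFor AveragingDatum.euler.form (schwartzL2 u₀) (Ico 0 S) V := by
      rw [Literature.Barriers.NavierStokesRegularity.AveragedTypeI.euler_form_eq]
      exact hV.mono (Ico_subset_Ico_right (by linarith))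
    have hu' : IsMildSolutionFor AveragingDatum.euler.form (schwartzL2 u₀) (Ico 0 S) u := by
      rw [Literature.Barriers.NavierStokesRegularity.AveragedTypeI.euler_form_eq]
      exact hu
    exact PerpetualPumpThesis.stub_uniqueness AveragingDatum.euler (schwartzL2 u₀) S V u hV' hu' t
      ht
  /- Step 2: the maximal Kato solution `uK` on `[0, T)`, `T = T_max(u₀) < ∞`, and its singular
  point. -/
  obtain ⟨hpos, htop, xs, uK, huK, hsing⟩ := exists_singularPoint_katoMaximalTime kato_local_holds
    IsKatoSolutionOn.continuation_of_bounded_holds IsKatoSolutionOn.farField_bound_holds one_pos h3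
    hwdiv hng
  set T : ℝ := (katoMaximalTime 1 (⇑u₀)).toReal with hTdef
  have hT : 0 < T := ENNReal.toReal_pos hpos.ne' htop.ne
  /- Step 3: Tao-class solutions on `[0, b n]`, `b n ↑ T`, glued to a classical solution on
  `[0, T)`. -/
  set b : ℕ → ℝ := fun n => T - T / ((n : ℝ) + 2) with hbdef
  have hb_pos : ∀ n, 0 < b n := fun n => by
    have hn2 : (2 : ℝ) ≤ (n : ℝ) + 2 := by have := n.cast_nonneg (α := ℝ); linarith
    have h1 : T / ((n : ℝ) + 2) ≤ T / 2 := div_le_div_of_nonneg_left hT.le (by norm_num) hn2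
    show 0 < T - T / ((n : ℝ) + 2)
    linarith
  have hb_lt : ∀ n, b n < T := fun n => by
    have : 0 < T / ((n : ℝ) + 2) := by positivity
    show T - T / ((n : ℝ) + 2) < T
    linarith
  have hcof : ∀ t, t < T → ∃ n, t < b n := by
    intro t ht
    obtain ⟨n, hn⟩ := exists_nat_gt (T / (T - t))
    refine ⟨n, ?_⟩
    have hpos' : 0 < T - t := sub_pos.2 ht
    rw [div_lt_iff₀ hpos'] at hn
    have h1 : T < ((n : ℝ) + 2) * (T - t) := by nlinarith
    have h2 : T / ((n : ℝ) + 2) < T - t := by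
      rw [div_lt_iff₀ (by positivity)]
      linarith [mul_comm (T - t) ((n : ℝ) + 2)]
    show t < T - T / ((n : ℝ) + 2)
    linarith
  have hex : ∀ n, ∃ (U : ℝ → EuclideanSpace ℝ (Fin 3) → EuclideanSpace ℝ (Fin 3))
      (P : ℝ → EuclideanSpace ℝ (Fin 3) → ℝ), IsTaoSolutionOn (b n) 1 (⇑u₀) U P := fun n =>
    exists_isTaoSolutionOn_of_isKatoSolutionOn one_pos hsm hdivW hdec huK (hb_pos n) (hb_lt n)
  choose U P hUP using hex
  have hagree : ∀ m n, ∀ t ∈ Ico 0 (min (b m) (b n)), U m t = U n t := fun m n =>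
    (hUP m).eq_of_isTaoSolutionOn (hUP n) one_pos (hb_pos m) (hb_pos n)
  obtain ⟨w, p, hwcl, hwU⟩ := IsClassicalNSSolutionOn.exists_glue_Ico_right (a := 0) (β := T)
    (fun n => (hb_lt n).le) hcof
    (fun n => (hUP n).classical.mono Ico_subset_Icc_self (uniqueDiffOn_Ico 0 (b n))) hagree
  -- `w` attains the datum and agrees a.e. slicewise with the Kato solution
  have hw0 : w 0 = ⇑u₀ := by
    rw [hwU 0 0 ⟨le_rfl, hb_pos 0⟩]; exact (hUP 0).initial
  have hwK : ∀ t ∈ Ico 0 T, w t =ᵐ[volume] uK t := by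
    intro t ht
    obtain ⟨n, hn⟩ := hcof t ht.2
    have hKn := huK.mono (hb_lt n).le
    rw [hwU n t ⟨ht.1, hn⟩]
    exact (hUP n).ae_eq_of_kato one_pos hKn.mild hKn.continuousInLpOn hKn.aestronglyMeasurable t
      ⟨ht.1, hn⟩
  have hwmeas : AEStronglyMeasurable (uncurry w) (volume.restrict (Ioo 0 T ×ˢ univ)) :=
    (hwcl.smooth_velocity.continuousOn.mono
      (prod_mono Ioo_subset_Ico_self Subset.rfl)).aestronglyMeasurable
        (measurableSet_Ioo.prod MeasurableSet.univ)
  /- Step 4: Leray–Hopf on `[0, T]` by comparison with Leray's global weak solution. -/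
  obtain ⟨uL, huL⟩ := leray_existence_R3_holds 1 one_pos (⇑u₀) h2 hwdiv
  have hLw : ∀ t ∈ Ioo 0 T, w t =ᵐ[volume] uL t := by
    intro t ht
    obtain ⟨n, hn⟩ := hcof t ht.2
    have hae := serrin_weak_strong_uniqueness_holds one_pos (hb_pos n)
      ((hUP n).isLerayHopfOn (hb_pos n)) h2 (q := ⊤) (r := ⊤) (by simp) (by simp)
      (memLqLp_top_top_of_isTaoSolutionOn (hUP n)) (huL (b n) (hb_pos n)) t ⟨ht.1, hn.le⟩
    rw [hwU n t ⟨ht.1.le, hn⟩]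
    exact hae.symm
  -- the completed velocity: `w` on `[0, T)`, Leray's slice at `t = T`
  set v₁ : ℝ → EuclideanSpace ℝ (Fin 3) → EuclideanSpace ℝ (Fin 3) :=
    fun t => if t ∈ Ioo 0 T then w t else uL t with hv₁_def
  set wf : ℝ → EuclideanSpace ℝ (Fin 3) → EuclideanSpace ℝ (Fin 3) := update v₁ 0 (⇑u₀)
    with hwf_def
  have hwf0 : wf 0 = ⇑u₀ := by rw [hwf_def, update_self]
  have hwf : ∀ t ∈ Ico 0 T, wf t = w t := by
    intro t ht
    rcases ht.1.eq_or_lt with h0 | ht0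
    · rw [← h0, hwf0, hw0]
    · rw [hwf_def, update_of_ne ht0.ne', show v₁ t = w t from if_pos ⟨ht0, ht.2⟩]
  have hv₁meas : AEStronglyMeasurable (uncurry v₁) (volume.restrict (Ioo 0 T ×ˢ univ)) := by
    refine hwmeas.congr ?_
    filter_upwards [ae_restrict_mem (measurableSet_Ioo.prod MeasurableSet.univ)] with z hz
    show w z.1 z.2 = v₁ z.1 z.2
    rw [show v₁ z.1 = w z.1 from if_pos hz.1]
  have hLH₁ : IsLerayHopfOn T 1 0 (⇑u₀) v₁ := by
    refine (huL T hT).congr_ae_slices hT hv₁meas fun t ht => ?_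
    by_cases htI : t ∈ Ioo 0 T
    · rw [show v₁ t = w t from if_pos htI]
      exact hLw t htI
    · rw [show v₁ t = uL t from if_neg htI]
  have hLH : IsLerayHopfOn T 1 0 (⇑u₀) wf := by
    rw [hwf_def]
    exact isLerayHopfOn_update_zero hLH₁ h2
  have hwfcl : IsClassicalNSSolutionOn (Ico 0 T) 1 0 wf p := hwcl.congr_slices hwf fun _ _ => rfl
  /- Step 5: maximality from the singular point `(T, xs)`. -/
  have hmax : ¬ HasSmoothExtensionPast 1 0 wf T := by
    rintro ⟨T', hTT', u', p', hcl', hagree'⟩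
    -- a backward cylinder inside the strip `(0, T) × (EuclideanSpace ℝ (Fin 3))`
    set r : ℝ := min 1 (T / 2) with hr
    have hr0 : 0 < r := lt_min one_pos (by linarith)
    have hrT : r ^ 2 < T := by
      have h1 : r ≤ 1 := min_le_left _ _
      have h2 : r ≤ T / 2 := min_le_right _ _
      nlinarith
    -- the extension is bounded on the compact closure of the cylinder
    have hK : IsCompact (Icc (T - r ^ 2) T ×ˢ Metric.closedBall xs r) :=
      isCompact_Icc.prod (isCompact_closedBall _ _)
    have hKsub : Icc (T - r ^ 2) T ×ˢ Metric.closedBall xs r ⊆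
        Ico 0 T' ×ˢ (univ : Set (EuclideanSpace ℝ (Fin 3))) :=
      prod_mono (fun t ht => ⟨by linarith [ht.1, sq_nonneg r], ht.2.trans_lt hTT'⟩) (subset_univ _)
    obtain ⟨M, hM⟩ :=
      hK.exists_bound_of_continuousOn (hcl'.smooth_velocity.continuousOn.mono hKsub)
    -- `uK = w = u'` a.e. on the cylinder
    have haeK : uncurry uK =ᵐ[volume.restrict (Ioo 0 T ×ˢ univ)] uncurry w :=
      ae_restrict_prod_of_forall_ae_eq (fun t ht => (hwK t ⟨ht.1.le, ht.2⟩).symm)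
        huK.aestronglyMeasurable hwmeas
    have hQsub :
        parabolicCylinder r (T, xs) ⊆ Ioo 0 T ×ˢ (univ : Set (EuclideanSpace ℝ (Fin 3))) := by
      intro z hz
      simp only [mem_parabolicCylinder] at hz
      exact ⟨⟨by linarith [hz.1.1], hz.1.2⟩, mem_univ _⟩
    have hQmeas : MeasurableSet (parabolicCylinder r ((T, xs) : ℝ × EuclideanSpace ℝ (Fin 3))) :=
      measurableSet_Ioo.prod Metric.isOpen_ball.measurableSet
    have hbd : ∀ᵐ z ∂(volume.restrict (parabolicCylinder r (T, xs))), ‖uncurry uK z‖ ≤ M := by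
      filter_upwards [ae_restrict_of_ae_restrict_of_subset hQsub haeK, ae_restrict_mem hQmeas]
        with z hz hzQ
      simp only [mem_parabolicCylinder] at hzQ
      have hzT : z.1 ∈ Ico 0 T := ⟨by linarith [hzQ.1.1], hzQ.1.2⟩
      rw [hz, show uncurry w z = u' z.1 z.2 by
        show w z.1 z.2 = u' z.1 z.2
        rw [hagree' z.1 hzT, hwf z.1 hzT]]
      exact hM z ⟨⟨hzQ.1.1.le, hzQ.1.2.le⟩, Metric.mem_closedBall.2 hzQ.2.le⟩
    have hfin : eLpNorm (uncurry uK) ⊤ (volume.restrict (parabolicCylinder r (T, xs))) < ⊤ := by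
      rw [eLpNorm_exponent_top]
      exact eLpNormEssSup_lt_top_of_ae_bound hbd
    exact hfin.ne (hsing r hr0)
  /- Step 6 (new): identification with `u` and equality of the two times. -/
  have hLHw : IsLerayHopfOn T 1 0 (wf 0) wf := by rw [hwf0]; exact hLH
  have hdecw : HasRapidSpatialDecay (wf 0) := by rw [hwf0]; exact hdec
  obtain ⟨U, hU, hUae⟩ := exists_isMildSolutionFor_of_classical hT u₀ hwfcl hLH hwf0
  have hu_e : ∀ {S₀ : ℝ}, S₀ ≤ S →
      IsMildSolutionFor AveragingDatum.euler.form (schwartzL2 u₀) (Ico 0 S₀) u := fun hle => by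
    rw [Literature.Barriers.NavierStokesRegularity.AveragedTypeI.euler_form_eq]
    exact hu.mono (Ico_subset_Ico_right hle)
  have hU_e : ∀ {S₀ : ℝ}, S₀ ≤ T →
      IsMildSolutionFor AveragingDatum.euler.form (schwartzL2 u₀) (Ico 0 S₀) U := fun hle => by
    rw [Literature.Barriers.NavierStokesRegularity.AveragedTypeI.euler_form_eq]
    exact hU.mono (Ico_subset_Ico_right hle)
  -- `T ≤ S`: otherwise the mild curve of `wf` is a mild extension of `u` past `S`
  have hTS : T ≤ S := by
    by_contra hlt
    push Not at hlt
    exact hnoext ⟨T, hlt, U, hU, fun t ht =>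
      PerpetualPumpThesis.stub_uniqueness AveragingDatum.euler (schwartzL2 u₀) S U u (hU_e hlt.le)
        (hu_e le_rfl) t ht⟩
  -- `u = U = [(wf ·)^ℂ]` on `[0, T)`
  have hlink : ∀ t ∈ Ico 0 T,
      ((u t : L2C) : EuclideanSpace ℝ (Fin 3) → EuclideanSpace ℂ (Fin 3)) =ᵐ[volume]
        complexify ∘ wf t := fun t ht => by
    rw [← PerpetualPumpThesis.stub_uniqueness AveragingDatum.euler (schwartzL2 u₀) T U u (hU_e le_rfl)
      (hu_e hTS) t ht]
    exact hUae t ht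
  -- `S ≤ T`: otherwise `u` continues `wf` classically past `T` (back end of `EulerTypeIGlue`)
  have hST : S ≤ T := by
    by_contra hlt
    push Not at hlt
    refine hmax (PerpetualPumpEulerTypeIGlue.stub_backEnd (a := 1) (b := 1) one_pos hT one_pos one_pos
      (by rwa [one_mul]) hwfcl hLHw hdecw u (fun s hs => hu.1 s hs) hu.2.1 fun t ht => ?_)
    rw [one_mul]
    filter_upwards [hlink t ht] with x hx
    rw [hx, Function.comp_apply, Complex.ofReal_one, one_smul]
  obtain rfl : T = S := le_antisymm hTS hST
  exact ⟨wf, p, ⟨hwfcl, hmax⟩, hLHw, hwf0, hlink⟩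


/-- **Navier–Stokes has a Schwartz-data `H¹⁰_df`-mild Type-I blow-up at ceiling `M`** (local notation,
verbatim the membership predicate of the crux's set at the Euler end `θ = 1`, as in
`Negative/ZeroDatumTools`). -/
local notation3 "nsTypeI[" M "]" =>
  ∃ u₀ : SchwartzMap (EuclideanSpace ℝ (Fin 3)) (EuclideanSpace ℝ (Fin 3)),
    Literature.Analysis.FluidPDE.VectorCalculus.IsDivFree ⇑u₀ ∧ ∃ S : ℝ, 0 < S ∧
    ∃ u : ℝ → Literature.Analysis.FluidPDE.Tao2016.L2C,
      Literature.Analysis.FluidPDE.Tao2016.IsMildSolutionFor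
        Literature.Analysis.FluidPDE.Tao2016.eulerForm
        (Literature.Analysis.FluidPDE.Tao2016.schwartzL2 u₀) (Set.Ico 0 S) u ∧
      (∀ t ∈ Set.Ico 0 S, MeasureTheory.eLpNorm (u t) ⊤ MeasureTheory.volume ≤
        ENNReal.ofReal (M / Real.sqrt (S - t))) ∧
      ¬ ∃ S' : ℝ, S < S' ∧ ∃ v : ℝ → Literature.Analysis.FluidPDE.Tao2016.L2C,
        Literature.Analysis.FluidPDE.Tao2016.IsMildSolutionFor
          Literature.Analysis.FluidPDE.Tao2016.eulerForm
          (Literature.Analysis.FluidPDE.Tao2016.schwartzL2 u₀) (Set.Ico 0 S') v ∧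
        ∀ t ∈ Set.Ico 0 S, v t = u t

/-- **Temperature floor — Leray's 1934 lower bound on the blow-up rate, in Tao's mild class.** With
Leray's universal constant `c > 0` (`leray_blowup_rate_top_holds`, here through
`Target.Negative.counterexample_leray_lower_bound`): if an `H¹⁰_df`-mild solution of the Navier–Stokes
form from a Schwartz divergence-free datum on `[0,S)` with no mild extension past `S` obeys the Type-I
bound `‖u t‖_∞ ≤ K/√(S-t)` on `[0,S)`, then `c ≤ K`. Indeed `u` is a maximal smooth solution `w` with
lifespan exactly `S` (`exists_linked_maximalSmooth`), `‖w 0‖_∞ ≥ c/√S` by Leray, and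
`‖w 0‖_∞ = ‖u 0‖_∞ ≤ K/√S`. [cite: Leray1934, §19 (3.9)] -/
theorem typeI_constant_ge :
    ∃ c : ℝ, 0 < c ∧ ∀ (K : ℝ) (u₀ : 𝓢(EuclideanSpace ℝ (Fin 3), EuclideanSpace ℝ (Fin 3))),
      VectorCalculus.IsDivFree ⇑u₀ → ∀ S : ℝ, 0 < S → ∀ u : ℝ → L2C,
      IsMildSolutionFor eulerForm (schwartzL2 u₀) (Ico 0 S) u →
      (∀ t ∈ Ico 0 S, eLpNorm (u t) ⊤ volume ≤ ENNReal.ofReal (K / Real.sqrt (S - t))) →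
      (¬ ∃ S' : ℝ, S < S' ∧ ∃ v : ℝ → L2C,
          IsMildSolutionFor eulerForm (schwartzL2 u₀) (Ico 0 S') v ∧ ∀ t ∈ Ico 0 S, v t = u t) →
      c ≤ K := by
  obtain ⟨c, hc, h⟩ := Target.Negative.counterexample_leray_lower_bound
  refine ⟨c, hc, fun K u₀ hdiv S hS u hu hrate hnoext => ?_⟩
  obtain ⟨w, p, hmax, hLH, hw0, hlink⟩ := exists_linked_maximalSmooth u₀ hdiv hS hu hnoext
  have hdec : HasRapidSpatialDecay (w 0) := by
    rw [hw0]
    exact hasRapidSpatialDecay_schwartz u₀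
  have h0 : (0 : ℝ) ∈ Ico 0 S := ⟨le_rfl, hS⟩
  have hlow := h one_pos hS hmax.1 hLH hdec hmax.2 0 h0
  have heq : eLpNorm ((u 0 : L2C) : EuclideanSpace ℝ (Fin 3) → EuclideanSpace ℂ (Fin 3)) ⊤ volume =
      eLpNorm (w 0) ⊤ volume := by
    rw [eLpNorm_congr_ae (hlink 0 h0)]
    exact eLpNorm_congr_norm_ae (Eventually.of_forall fun x => by
      rw [Function.comp_apply, norm_complexify])
  have hup : eLpNorm (w 0) ⊤ volume ≤ ENNReal.ofReal (K / Real.sqrt (S - 0)) := by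
    rw [← heq]
    exact hrate 0 h0
  have hle := hlow.trans hup
  rw [Real.sqrt_one, mul_one, sub_zero] at hle
  have hS' : 0 < Real.sqrt S := Real.sqrt_pos.2 hS
  rcases ENNReal.ofReal_le_ofReal_iff'.1 hle with h1 | h1
  · exact (div_le_div_iff_of_pos_right hS').1 h1
  · exact absurd h1 (not_le.2 (div_pos hc hS'))

/-- **The admissible Type-I ceilings of Schwartz-data mild Navier–Stokes blow-ups are bounded below by a
positive constant** (`typeI_constant_ge`, read through the crux's membership predicate at `θ = 1`).
[cite: Leray1934, §19 (3.9)] -/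
theorem exists_typeIFloor : ∃ c : ℝ, 0 < c ∧ ∀ K : ℝ, nsTypeI[K] → c ≤ K := by
  obtain ⟨c, hc, h⟩ := typeI_constant_ge
  exact ⟨c, hc, fun K ⟨u₀, hdiv, S, hS, u, hu, hrate, hno⟩ => h K u₀ hdiv S hS u hu hrate hno⟩

/-- **Temperature floor, qualitative form**: Navier–Stokes does NOT have Schwartz-data `H¹⁰_df`-mild
Type-I blow-ups at every positive ceiling — unconditionally (the clause that `Negative/ZeroDatumTools`
could only derive FROM the crux, `not_forall_pos_nsTypeI_of_boundedTemperatureClosed`).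
[cite: Leray1934, §19 (3.9)] -/
theorem nsTypeI_not_forall_pos : ¬ ∀ K : ℝ, 0 < K → nsTypeI[K] := by
  obtain ⟨c, hc, h⟩ := exists_typeIFloor
  intro hall
  have h1 := h (c / 2) (hall (c / 2) (half_pos hc))
  linarith

end BoundedTemperatureClosed.Negative

end Summit.NavierStokesRegularity.NavierStokesRegularity.Theorems

end
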